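import Summits.QuantumFields.YangMills.Theorems.SmallFieldWideningLargeFieldMassRefinementTailOfIntCoreRec
import HarnessLib

/-!
# Route `SmallFieldWidening` — crux r3 `LargeFieldMassRefinementTail` (stmt-QuantumFields-22884) CLOSES FROM **ONE** (α) RECORD PER BLOCK SIZE
# (support file, leaf; lead `ym-line-sfw-p2` gen 2, line `birth`)

WHY.  The landed closers of the line (`…OfIntCoreRec`: `largeFieldMassRefinementTail_of_intCoreRec` / `_of_laneRecordsChi`, w2 ∘ w3) take the K2-L
programme's sockets of route `UnitScaleTilt` AS STATED FOR ITS OWN CRUX `HistoryTailL` (stmt-QuantumFields-19936): `AlphaInputsT3AC.IntCoreRec L` and the χ-record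
`AlphaInputsT3ACv3RecChi L` both read «∃ thresholds (b₁, p₁), ∀ profiles (b₀, p₀) beyond them, ∃ a primitive-constants record 𝔠 with exactly that p-function …» —
records at EVERY large profile, because K2-L must serve profiles beyond arbitrary thresholds (the tilt side's floor, [King1986] (3.12)).  Crux r3 needs far less:
`LargeFieldMassRefinementTailOfHeightTail.largeFieldMassRefinementTail_of_averagedTail` consumes the averaged-height tail package at ONE profile per block size, and
the K2 tree's per-plaquette high tail from ONE record (`HistoryTailLaneTailInt.perPlaquetteHigh_int`) already carries an admissible profile (`𝔠.p₀ = 2𝔠.r₀ + 1 > 2`,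
`1 + 3𝔠.r₀/2 < 𝔠.p₀` from `1 ≤ 𝔠.r₀`).  THIS FILE records the sharper dependency, sorry-free:

* `averagedTailPkg_of_oneIntCore` — ONE record `𝔠 : AlphaConsts L 2` with the `IntCoreRec` BODY (per family/coupling a family of data cores with a fixed
  [Balaban1985Variational] constant `a₁` and the interior (47)′ row under `θBal ≤ a₁`) per odd `L > 1` ⇒ the averaged-height tail package `AvgTailPkg` for every `L`
  (tail chain of `LargeFieldMassRefinementTail.averagedTailPkg_of_perPlaquetteHighL` at the record's own profile: `budget_of_c`, `perPlaquette_of_split`,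
  `stub_tailOfPerPlaquette`);
* `largeFieldMassRefinementTail_of_oneIntCore` — hence the crux BY NAME (w2's level-shift bridge);
* `intCoreBody_of_ofV3ChiAt` — ONE χ-record `AlphaInputsT3AC.OfV3ChiAt F 𝔠 a₀ a₁` (all families of block size `L`) instantiates that body (★alpha-1's
  `pkgAtV3Chi … |>.toCore`, `pkgAtV3Chi_a₁`, `HistoryTailLaneTailChi.dataIntV3_ineq47AE_of_chi` — the record-level content of `intCoreRec_of_laneRecordsChi`);
* `largeFieldMassRefinementTail_of_oneChiRecord` — **r3 ⇐ ONE χ-record per odd block size `L > 1`, at ANY constants the record likes**: the FIRST (α) record the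
  lane `pub-balaban3d` exhibits at some profile closes r3, before the «beyond arbitrary thresholds» uniformity that 19936 / 20520's shared stub 2′χ asks for.

WHAT THIS IS NOT: no (α) record is constructed here (that is [Balaban1985UV3] Thms 1–2 at d = 3, OPEN in the tree); the crux stays open; nothing bears on the
Yang–Mills mass gap (rung R3 record only).
-/

set_option autoImplicit false

noncomputable section

open MeasureTheory Filter Topology
open Literature.MathematicalPhysics.QuantumFieldTheory
open Literature.MathematicalPhysics.QuantumFieldTheory.Balaban1983to89
open Literature.MathematicalPhysics.QuantumFieldTheory.Balaban1983to89.Missing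
open Literature.MathematicalPhysics.QuantumFieldTheory.Balaban1983to89.T3ContinuumYM3Torus
open Literature.MathematicalPhysics.QuantumFieldTheory.Balaban1983to89.T3UnitScaleTilt
open Literature.MathematicalPhysics.QuantumFieldTheory.Balaban1983to89.T3UnitLawDensityEML
open Literature.MathematicalPhysics.QuantumFieldTheory.Balaban1983to89.T3BareTailProfile
open Literature.MathematicalPhysics.QuantumFieldTheory.Balaban1983to89.T3ThresholdSmallness (sqrt_coupling_pos_le)
open Literature.MathematicalPhysics.QuantumFieldTheory.Balaban1983to89.T3Thresholds (coupling_le_one)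
open Literature.MathematicalPhysics.QuantumFieldTheory.Balaban1983to89.T3AlphaInputsAC
open Literature.MathematicalPhysics.QuantumFieldTheory.Balaban1983to89.T3AlphaInputsACSchemas
open Summit.QuantumFields.Balaban3D.Carriers (suGroupModel Hist)
open Summit.QuantumFields.Balaban3D.Proofs.Primitives (AlphaConsts)
open Summit.QuantumFields.YangMills.Theorems
open Summit.QuantumFields.YangMills.Theorems.HistoryTailLaneNumerator (budget_of_c)
open Summit.QuantumFields.YangMills.Theorems.HistoryTailLaneTailInt (perPlaquetteHigh_int)
open Summit.QuantumFields.YangMills.Theorems.HistoryTailLaneTailChi (dataIntV3_ineq47AE_of_chi)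
open Summit.QuantumFields.YangMills.Theorems.LargeFieldMassRefinementTailOfHeightTail (largeFieldMassRefinementTail_of_averagedTail)

namespace Summit.QuantumFields.YangMills.Theorems.LargeFieldMassRefinementTailOfOneRecord

/-- **THE AVERAGED-HEIGHT TAIL PACKAGE FROM ONE (α) RECORD PER BLOCK SIZE.**  If for every odd block size `L > 1` there are ONE primitive-constants record
`𝔠 : AlphaConsts L 2` and ONE [Balaban1985Variational] constant `a₁ > 0` such that every three-torus family with `F.L = L` at every coupling
`0 < γ ≤ (min 𝔠.γ₀ 1)²` admits a family of data cores `qf K : PkgCoreV3 …` with constant `a₁` whose interior datum satisfies the lower a.e. row (47)′ at all levels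
`j ≤ K` once `θBal ≤ a₁` (the BODY of `AlphaInputsT3AC.IntCoreRec L` at the record's own profile), then for EVERY `L` there are `b₀ > 0`, `p₀ > 2`, `0 < γ₁ ≤ 1` with
`AveragedTailAt F γ b₀ p₀` for all families with `F.L = L` and all `0 < γ ≤ γ₁` — with `(b₀, p₀) := (𝔠.b₀, 𝔠.p₀)`: the record's profile is admissible because
`𝔠.p₀ = 2𝔠.r₀ + 1` and `1 ≤ 𝔠.r₀`.  Proof: `perPlaquetteHigh_int` at the record, then the tail chain of `averagedTailPkg_of_perPlaquetteHighL` verbatim.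
[cite: Balaban1985UV3, (5) p.256, (47) p.267 and (71) p.273] -/
theorem averagedTailPkg_of_oneIntCore
    (hone : ∀ (L : ℕ), Odd L → 1 < L →
      ∃ (𝔠 : AlphaConsts L (suGroupModel 2).N) (a₁ : ℝ), 0 < a₁ ∧
        ∀ (F : T3Family) (hF : F.L = L) (γ : ℝ) (hγ : 0 < γ) (hγ1 : γ ≤ (min (hF ▸ 𝔠).gamma0 1) ^ 2),
          ∃ qf : ∀ K, AlphaInputsT3AC.PkgCoreV3 F (hF ▸ 𝔠) γ hγ hγ1 K, (∀ K, (qf K).a₁ = a₁) ∧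
            ((∀ i, θBal F.L γ (hF ▸ 𝔠).b₀ (hF ▸ 𝔠).p₀ i ≤ a₁) →
              ∀ (π : AlphaInputsT3AC.PolymerT3 F) (K j : ℕ), j ≤ K → Ineq47AE (AlphaInputsT3AC.dataIntV3 qf π) K j)) :
    ∀ L : ℕ, ∃ b₀ p₀ γ₁ : ℝ, 0 < b₀ ∧ 2 < p₀ ∧ 0 < γ₁ ∧ γ₁ ≤ 1 ∧
      ∀ (F : T3Family) (γ : ℝ), F.L = L → 0 < γ → γ ≤ γ₁ → AveragedTailAt F γ b₀ p₀ := by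
  intro L
  by_cases hL : Odd L ∧ 1 < L
  · obtain ⟨𝔠, a₁, ha1, h𝔠⟩ := hone L hL.1 hL.2
    obtain ⟨κ, γ₁, cSF, hκ, hγ₁, hγ₁1, hc0, -, h⟩ := perPlaquetteHigh_int L hL.1 hL.2 𝔠 a₁ ha1 h𝔠
    have hb : 0 < 𝔠.b₀ := 𝔠.b₀_pos
    have hp2 : 2 < 𝔠.p₀ := 𝔠.two_lt_p₀
    have hr₀ : 0 ≤ 𝔠.r₀ := zero_le_one.trans 𝔠.one_le_r₀
    have hp : 1 + 3 * 𝔠.r₀ / 2 < 𝔠.p₀ := by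
      have := 𝔠.one_le_r₀
      show 1 + 3 * 𝔠.r₀ / 2 < 2 * 𝔠.r₀ + 1
      linarith
    obtain ⟨C₆, c, hC₆, hc, hbud⟩ := budget_of_c 𝔠.b₀ 𝔠.p₀ 𝔠.r₀ κ cSF hb hr₀ hκ hp hc0
    refine ⟨𝔠.b₀, 𝔠.p₀, γ₁, hb, hp2, hγ₁, hγ₁1, fun F γ hFL hγ hle => ?_⟩
    have hγ1 : γ ≤ 1 := hle.trans hγ₁1
    have hp01 : (1 : ℝ) ≤ 𝔠.p₀ := by linarith
    have hL1 : 1 ≤ F.L := F.hL.2.le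
    obtain ⟨j₀, C, A, hC, hhigh⟩ := h F γ hFL hγ hle
    have hhigh' : ∃ (C : ℝ) (A : ℕ) (c : ℝ), 0 ≤ C ∧ 0 < c ∧
        ∀ (K j : ℕ), j₀ < j → j ≤ K → ∀ p : Plaq (F.P K) j,
          (gibbsK F ℰp γ K).real
              {U | θBal F.L γ 𝔠.b₀ 𝔠.p₀ (K - j) ≤
                GaugeGroup.dist1 (GaugeField.plaqHol
                  (Averaging.iter (fun _ => BlockAveraging.blockAvg ℰp) j U) p)} ≤
            C * (F.scheme ℰp γ).β (K - j) ^ A *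
              Real.exp (-(c * B10.pFun 𝔠.b₀ 𝔠.p₀ (Real.sqrt (γ * ((F.L : ℝ)⁻¹) ^ (K - j))) ^ 2)) := by
      refine ⟨C * C₆, A, c, mul_nonneg hC hC₆, hc, fun K j hj hjK p => ?_⟩
      have hg := sqrt_coupling_pos_le hL1 hγ (K - j)
      have hg1 := coupling_le_one hL1 hγ hγ1 (K - j)
      have hβA : 0 ≤ C * (F.scheme ℰp γ).β (K - j) ^ A :=
        mul_nonneg hC (pow_nonneg (F.scheme_β_nonneg ℰp hγ.le (K - j)) A)
      calc (gibbsK F ℰp γ K).real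
              {U | θBal F.L γ 𝔠.b₀ 𝔠.p₀ (K - j) ≤
                GaugeGroup.dist1 (GaugeField.plaqHol
                  (Averaging.iter (fun _ => BlockAveraging.blockAvg ℰp) j U) p)}
            ≤ C * (F.scheme ℰp γ).β (K - j) ^ A *
                Real.exp (-(cSF * B10.pFun 𝔠.b₀ 𝔠.p₀ (Real.sqrt (γ * ((F.L : ℝ)⁻¹) ^ (K - j))) ^ 2) +
                  κ * (1 + Real.log (Real.sqrt (γ * ((F.L : ℝ)⁻¹) ^ (K - j)))⁻¹) ^ (2 + 3 * 𝔠.r₀)) := hhigh K j hj hjK p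
        _ ≤ C * (F.scheme ℰp γ).β (K - j) ^ A *
                (C₆ * Real.exp (-(c * B10.pFun 𝔠.b₀ 𝔠.p₀ (Real.sqrt (γ * ((F.L : ℝ)⁻¹) ^ (K - j))) ^ 2))) :=
              mul_le_mul_of_nonneg_left (hbud _ hg.1 hg1) hβA
        _ = C * C₆ * (F.scheme ℰp γ).β (K - j) ^ A *
                Real.exp (-(c * B10.pFun 𝔠.b₀ 𝔠.p₀ (Real.sqrt (γ * ((F.L : ℝ)⁻¹) ^ (K - j))) ^ 2)) := by ring
    have hPP := HistoryTailBoundedHeight.perPlaquette_of_split j₀ F hγ hγ1 hb.le 𝔠.p₀ hhigh'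
    exact HistoryTailBirthV3b.stub_tailOfPerPlaquette F γ 𝔠.b₀ 𝔠.p₀ hγ hγ1 hb hp01 hPP
  · refine ⟨1, 3, 1, one_pos, by norm_num, one_pos, le_rfl, fun F γ hFL _ _ => ?_⟩
    have hF := F.hL
    rw [hFL] at hF
    exact (hL hF).elim

/-- **r3 ⇐ ONE `IntCoreRec`-BODY RECORD PER ODD BLOCK SIZE**: `averagedTailPkg_of_oneIntCore`, then w2's level-shift bridge
`largeFieldMassRefinementTail_of_averagedTail` — the crux `LargeFieldMassRefinementTail` BY NAME, CONDITIONALLY. [cite: Balaban1985UV3, (7) p.257 and (71) p.273] -/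
theorem largeFieldMassRefinementTail_of_oneIntCore
    (hone : ∀ (L : ℕ), Odd L → 1 < L →
      ∃ (𝔠 : AlphaConsts L (suGroupModel 2).N) (a₁ : ℝ), 0 < a₁ ∧
        ∀ (F : T3Family) (hF : F.L = L) (γ : ℝ) (hγ : 0 < γ) (hγ1 : γ ≤ (min (hF ▸ 𝔠).gamma0 1) ^ 2),
          ∃ qf : ∀ K, AlphaInputsT3AC.PkgCoreV3 F (hF ▸ 𝔠) γ hγ hγ1 K, (∀ K, (qf K).a₁ = a₁) ∧
            ((∀ i, θBal F.L γ (hF ▸ 𝔠).b₀ (hF ▸ 𝔠).p₀ i ≤ a₁) →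
              ∀ (π : AlphaInputsT3AC.PolymerT3 F) (K j : ℕ), j ≤ K → Ineq47AE (AlphaInputsT3AC.dataIntV3 qf π) K j)) :
    Summit.QuantumFields.YangMills.Theses.SmallFieldWidening.LargeFieldMassRefinementTail :=
  largeFieldMassRefinementTail_of_averagedTail (averagedTailPkg_of_oneIntCore hone)

/-- **ONE χ-RECORD INSTANTIATES THE `IntCoreRec` BODY AT ITS OWN CONSTANTS** (the record-level content of `HistoryTailLaneTailChi.intCoreRec_of_laneRecordsChi`):
from `AlphaInputsT3AC.OfV3ChiAt F 𝔠 a₀ a₁` with `0 < a₀`, `0 < a₁`, `𝔠.B₃·a₁ ≤ a₀`, the data cores are `(hχ.pkgAtV3Chi …).toCore`, their constant is `a₁`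
(`pkgAtV3Chi_a₁`), and the interior (47)′ row is `dataIntV3_ineq47AE_of_chi`. [cite: Balaban1985UV3, (47) p.267 and Thm 2 p.272; Balaban1985Variational, Thm 1 (8) p.279] -/
theorem intCoreBody_of_ofV3ChiAt {F : T3Family} {𝔠 : AlphaConsts F.L (suGroupModel 2).N} {a₀ a₁ : ℝ}
    (hχ : AlphaInputsT3AC.OfV3ChiAt F 𝔠 a₀ a₁) (hc : 0 < a₀ ∧ 0 < a₁ ∧ 𝔠.B₃ * a₁ ≤ a₀)
    (γ : ℝ) (hγ : 0 < γ) (hγ1 : γ ≤ (min 𝔠.gamma0 1) ^ 2) :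
    ∃ qf : ∀ K, AlphaInputsT3AC.PkgCoreV3 F 𝔠 γ hγ hγ1 K, (∀ K, (qf K).a₁ = a₁) ∧
      ((∀ i, θBal F.L γ 𝔠.b₀ 𝔠.p₀ i ≤ a₁) →
        ∀ (π : AlphaInputsT3AC.PolymerT3 F) (K j : ℕ), j ≤ K → Ineq47AE (AlphaInputsT3AC.dataIntV3 qf π) K j) := by
  refine ⟨fun K => (hχ.pkgAtV3Chi hc γ hγ hγ1 K).toCore, fun K => hχ.pkgAtV3Chi_a₁ hc γ hγ hγ1 K, fun ha π K j hj => ?_⟩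
  refine dataIntV3_ineq47AE_of_chi _ π K (hχ.pkgAtV3Chi hc γ hγ hγ1 K) rfl (fun i => ?_) j hj
  rw [hχ.pkgAtV3Chi_a₁ hc γ hγ hγ1 K]
  exact ha i

/-- **r3 ⇐ ONE χ-RECORD PER ODD BLOCK SIZE `L > 1`, AT ANY CONSTANTS**: if for every odd `L > 1` there are ONE primitive-constants record `𝔠` and constants
`0 < a₀`, `0 < a₁` with `𝔠.B₃·a₁ ≤ a₀` such that the χ-package `AlphaInputsT3AC.OfV3ChiAt F 𝔠 a₀ a₁` holds for every three-torus family of block size `L`, then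
`LargeFieldMassRefinementTail` holds.  Strictly weaker hypothesis than the shared stub 2′χ `∀ L, Odd L → 1 < L → AlphaInputsT3ACv3RecChi L` of cruxes
stmt-QuantumFields-19936 / 20520 (records at EVERY profile beyond thresholds): the first record the (α) lane exhibits closes r3. [cite: Balaban1985UV3, Thm 2 p.272 and (71) p.273; Balaban1985Variational, Thm 1 (8) p.279] -/
theorem largeFieldMassRefinementTail_of_oneChiRecord
    (hone : ∀ (L : ℕ), Odd L → 1 < L →
      ∃ (𝔠 : AlphaConsts L (suGroupModel 2).N) (a₀ a₁ : ℝ), 0 < a₀ ∧ 0 < a₁ ∧ 𝔠.B₃ * a₁ ≤ a₀ ∧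
        ∀ (F : T3Family) (hF : F.L = L), AlphaInputsT3AC.OfV3ChiAt F (hF ▸ 𝔠) a₀ a₁) :
    Summit.QuantumFields.YangMills.Theses.SmallFieldWidening.LargeFieldMassRefinementTail := by
  refine largeFieldMassRefinementTail_of_oneIntCore fun L hLo hL => ?_
  obtain ⟨𝔠, a₀, a₁, ha0, ha1, hw, hF⟩ := hone L hLo hL
  refine ⟨𝔠, a₁, ha1, fun F hFL γ hγ hγ1 => ?_⟩
  subst hFL
  exact intCoreBody_of_ofV3ChiAt (hF F rfl) ⟨ha0, ha1, hw⟩ γ hγ hγ1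

/-- **2′χ ⇒ the one-record hypothesis** (sanity link: the shared stub of 19936 / 20520 is STRONGER — instantiate its record at the thresholds themselves), so the
landed closer `…OfIntCoreRec.largeFieldMassRefinementTail_of_laneRecordsChi` is `largeFieldMassRefinementTail_of_oneChiRecord ∘ oneChiRecord_of_laneRecordsChi`
(not restated here: it is importable). [cite: Balaban1985UV3, Thm 2 p.272] -/
theorem oneChiRecord_of_laneRecordsChi
    (hrec : ∀ L : ℕ, Odd L → 1 < L → Summit.QuantumFields.YangMills.Theorems.AlphaInputsT3ACv3RecChi L) :
    ∀ (L : ℕ), Odd L → 1 < L →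
      ∃ (𝔠 : AlphaConsts L (suGroupModel 2).N) (a₀ a₁ : ℝ), 0 < a₀ ∧ 0 < a₁ ∧ 𝔠.B₃ * a₁ ≤ a₀ ∧
        ∀ (F : T3Family) (hF : F.L = L), AlphaInputsT3AC.OfV3ChiAt F (hF ▸ 𝔠) a₀ a₁ := by
  intro L hLo hL
  obtain ⟨b₁, p₁, h⟩ := hrec L hLo hL
  obtain ⟨𝔠, a₀, a₁, -, -, ha0, ha1, hw, hF⟩ := h b₁ p₁ le_rfl le_rfl
  exact ⟨𝔠, a₀, a₁, ha0, ha1, hw, hF⟩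

end Summit.QuantumFields.YangMills.Theorems.LargeFieldMassRefinementTailOfOneRecord

end
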